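import Literature.MathematicalPhysics.QuantumFieldTheory.AnisotropicTemporalTwistSpatialDoubling
import HarnessLib

/-!
# Strong coupling: the temporal-plane electric-flux ratio under TIME doubling, and 't Hooft's dyadic volume ratchet
# `t_z(2^{n+1}) ≤ t_z(2^{n+2})` on the symmetric four-torus for `β ≤ β₀(ρ, z)`, plane `(0,3)`

Topic `Literature/MathematicalPhysics/QuantumFieldTheory`; sequel of `AnisotropicTemporalTwistSpatialDoubling.lean` (one SPATIAL doubling,
`t_z(L_s, L_t) ≤ t_z(2L_s, L_t)`).  The same floor (finite-temperature Tomboulis–Yaffe inequality + temporal-plaquette floor, exponential in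
the twisted area `L_s L_t`) and ceiling (Kotecký–Preiss, exponential in TWICE the area of the larger box) give the TIME doubling
`t_z(L_s, L_t) ≤ t_z(L_s, 2L_t)`, and the two doublings compose to the full doubling of the symmetric torus,
`t_z(L) ≤ t_z(2L, L) ≤ t_z(2L)` (`twistedPartitionFunctionAniso_self`):

* `twistedPartitionFunctionAniso_03_floor` — `|1−ω|² (βv/768)^{L_tL_s} ≤ 8 N^{L_tL_s + 2L_s} (1 − t_z(L_s, L_t))` (dyadic `L_s ≥ 4`, `L_t ≥ 2`);
* `twistedPartitionFunctionAniso_03_ceiling` — `1 − t_z(L_s, L_t) ≤ 12 L_s³ L_t (4·97²e·Nβ)^{L_sL_t}` (every box, `Nβ ≤ 1/(4·97²e²)`);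
* ★★ `twistedPartitionFunctionAniso_03_ratio_le_time_double` — `t_z(L_s, L_t) ≤ t_z(L_s, 2L_t)` for `β ≤ β₀(ρ, ω)` (same explicit threshold
  as the spatial doubling);
* ★★ `twistedPartitionFunction_03_ratio_le_double` — symmetric torus: `t_z(L) ≤ t_z(2L)` for dyadic `L = 2n+2 ≥ 4`, `β ≤ β₀`;
* ★★★ `exists_beta0_twistedPartitionFunction_03_dyadic_ratchet` — `∃ β₀ > 0, ∀ 0 < β ≤ β₀, ∀ n ≥ 1,
  t_z(2^{n+1} − 2 + 2) ≤ t_z(2^{n+2} − 2 + 2)` in the letters of the summit's volume-ratchet crux (plane `(0,3)`).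

HONEST FRAMING: this is the STRONG-COUPLING, SCALAR-TWIST (`ρ(z) = ω·1`, e.g. an irreducible `ρ`), TEMPORAL-PLANE model case of the dyadic
volume ratchet — at `β ≤ β₀` the vortex free energy `−ln t_z` is exponentially SMALL in the area `L_s L_t` (`t_z ↑ 1`: light centre
vortex, i.e. HEAVY electric flux in 't Hooft's dual language; erratum to the first landed wording «t_z → 0»), and the ratchet
holds because consecutive dyadic boxes differ by a factor `≥ 2` in that area.  It says nothing at weak or intermediate coupling (the crux
asks for every `β > 0`), nothing for a reducible faithful `ρ` on which `z` does not act by a scalar, and nothing for the spatial planes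
`(i,j)` beyond what the symmetric torus' axis permutations give elsewhere in the tree.

References: E. T. Tomboulis, L. G. Yaffe, Commun. Math. Phys. 100 (1985) 313 [TomboulisYaffe1985] App. I, §2 (2.10)–(2.12); G. 't Hooft,
Nucl. Phys. B153 (1979) 141 [tHooft1979Flux] §5; K. R. Ito, E. Seiler, arXiv:0803.3019 [ItoSeiler2008Further] Thm 2.2 (1); G. Münster,
Nucl. Phys. B180 (1981) 23 (strong-coupling area law of the electric-flux free energy).
-/

noncomputable section

open MeasureTheory
open scoped BigOperators
open Literature.Barriers.QuantumFields

namespace Literature.MathematicalPhysics.QuantumFieldTheory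

/-! ### The arithmetic of floor versus ceiling (time doubling) -/

section Arith

/-- plumbing: `(2n+2)³ · 2(2m+2) ≤ 8 · 16^{(2m+2)(2n+2)}`. [folklore] -/
private theorem box_volume_le_pow_time (m n : ℕ) :
    (2 * n + 2) ^ 3 * (2 * (2 * m + 2)) ≤ 8 * 16 ^ ((2 * m + 2) * (2 * n + 2)) := by
  set A : ℕ := (2 * m + 2) * (2 * n + 2) with hA
  have h1 : (2 * n + 2) ^ 3 * (2 * m + 2) ≤ A ^ 4 := by
    rw [hA, mul_pow]
    calc (2 * n + 2) ^ 3 * (2 * m + 2) = (2 * m + 2) ^ 1 * (2 * n + 2) ^ 3 := by ring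
      _ ≤ (2 * m + 2) ^ 4 * (2 * n + 2) ^ 4 :=
        Nat.mul_le_mul (Nat.pow_le_pow_right (by omega) (by norm_num)) (Nat.pow_le_pow_right (by omega) (by norm_num))
  have h2 : A ^ 4 ≤ 16 ^ A := by
    calc A ^ 4 ≤ (2 ^ A) ^ 4 := Nat.pow_le_pow_left (Nat.lt_two_pow_self).le 4
      _ = 16 ^ A := by rw [← pow_mul, mul_comm, pow_mul]; norm_num
  calc (2 * n + 2) ^ 3 * (2 * (2 * m + 2)) = 2 * ((2 * n + 2) ^ 3 * (2 * m + 2)) := by ring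
    _ ≤ 8 * 16 ^ A := by have := h1.trans h2; omega

/-- **Floor beats ceiling (time doubling).**  With `A = (2m+2)(2n+2)`, `N ≥ 1`, `0 < δ ≤ 4`, `0 < β ≤ cδ/(12288 C² N⁴)`:
`12 L_s³ (2L_t) (CNβ)^{2A} · 8 N^{A + 2L_s} ≤ δ (cβ)^A`. [folklore] -/
private theorem doubling_arith_time {N C c δ β : ℝ} (m n : ℕ) (hN : 1 ≤ N) (hC : 0 < C) (hc : 0 < c) (hδ0 : 0 < δ)
    (hδ4 : δ ≤ 4) (hβ0 : 0 < β) (hβ : β ≤ c * δ / (12288 * C ^ 2 * N ^ 4)) :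
    12 * (((2 * n + 2 : ℕ) : ℝ) ^ 3 * ((2 * (2 * m + 2) : ℕ) : ℝ)) * (C * (N * β)) ^ ((2 * n + 2) * (2 * (2 * m + 2))) *
        (8 * N ^ ((2 * m + 2) * (2 * n + 2) + 2 * (2 * n + 2))) ≤
      δ * (c * β) ^ ((2 * m + 2) * (2 * n + 2)) := by
  set A : ℕ := (2 * m + 2) * (2 * n + 2) with hA
  have hA1 : 1 ≤ A := by rw [hA]; nlinarith
  have hNpos : 0 < N := by linarith
  set x : ℝ := c * β with hx
  have hx0 : 0 < x := mul_pos hc hβ0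
  set u : ℝ := 16 * C ^ 2 * N ^ 4 * β / c with hu
  have hu0 : 0 ≤ u := by positivity
  have hu1 : u ≤ δ / 768 := by
    calc u ≤ 16 * C ^ 2 * N ^ 4 * (c * δ / (12288 * C ^ 2 * N ^ 4)) / c := by rw [hu]; gcongr
      _ = δ / 768 := by field_simp; norm_num
  have hule : u ≤ 1 := by linarith
  have hS : (((2 * n + 2 : ℕ) : ℝ) ^ 3 * ((2 * (2 * m + 2) : ℕ) : ℝ)) ≤ 8 * 16 ^ A := by
    exact_mod_cast box_volume_le_pow_time m n
  have hNpow : N ^ (A + 2 * (2 * n + 2)) ≤ N ^ (2 * A) := by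
    refine pow_le_pow_right₀ hN ?_
    rw [hA]; nlinarith
  have hκ : (C * (N * β)) ^ ((2 * n + 2) * (2 * (2 * m + 2))) = ((C * (N * β)) ^ 2) ^ A := by
    rw [show (2 * n + 2) * (2 * (2 * m + 2)) = 2 * A from by rw [hA]; ring, pow_mul]
  have hux : u * x = 16 * (C * (N * β)) ^ 2 * N ^ 2 := by
    rw [hu, hx]; field_simp
  have hN2 : N ^ (2 * A) = (N ^ 2) ^ A := by rw [pow_mul]
  calc 12 * (((2 * n + 2 : ℕ) : ℝ) ^ 3 * ((2 * (2 * m + 2) : ℕ) : ℝ)) * (C * (N * β)) ^ ((2 * n + 2) * (2 * (2 * m + 2))) *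
        (8 * N ^ (A + 2 * (2 * n + 2)))
      = 12 * (((2 * n + 2 : ℕ) : ℝ) ^ 3 * ((2 * (2 * m + 2) : ℕ) : ℝ)) * ((C * (N * β)) ^ 2) ^ A *
          (8 * N ^ (A + 2 * (2 * n + 2))) := by rw [hκ]
    _ ≤ 12 * (8 * 16 ^ A) * ((C * (N * β)) ^ 2) ^ A * (8 * N ^ (2 * A)) := by gcongr
    _ = 768 * (16 * (C * (N * β)) ^ 2 * N ^ 2) ^ A := by rw [hN2, mul_pow, mul_pow]; ring
    _ = 768 * (u ^ A * x ^ A) := by rw [← hux, mul_pow]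
    _ ≤ 768 * (u * x ^ A) := by
        gcongr
        calc u ^ A ≤ u ^ 1 := pow_le_pow_of_le_one hu0 hule hA1
          _ = u := pow_one u
    _ ≤ 768 * (δ / 768 * x ^ A) := by gcongr
    _ = δ * x ^ A := by ring

end Arith

/-! ### Floor, ceiling, time doubling -/

section Main

variable {G : Type*} [Group G] [TopologicalSpace G] [IsTopologicalGroup G] [CompactSpace G] [MeasurableSpace G] [BorelSpace G]
  [SecondCountableTopology G] {N : ℕ} (ρ : G →* Matrix (Fin N) (Fin N) ℂ)

/-- **FLOOR** (the finite-temperature Tomboulis–Yaffe inequality read on the anisotropic `Fin`-box).  Unitary continuous `ρ` (`N ≥ 1`),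
central `z` with `ρ(z) = ω·1`, `|ω| = 1`, `ω ≠ 1`, `v = ∫ ((Re tr ρ)₊)² dg`, `0 < β ≤ 1` with `βv ≤ 4`; `L_t = 2m+2`, `L_s = 2n+2`,
`m + 1 = 2^a`, `n + 1 = 2^b`, `n ≥ 1`:
`|1−ω|² (βv/768)^{L_tL_s} ≤ 8 N^{L_tL_s + 2L_s} (1 − Z(z;(0,3);L_s,L_t)/Z(1;(0,3);L_s,L_t))`.
[cite: TomboulisYaffe1985, App. I and §2 eqs. (2.10)–(2.12)] [cite: BorgsSeiler1983, §II.3 (II.20)–(II.22)] -/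
theorem twistedPartitionFunctionAniso_03_floor (hρu : ∀ g, ρ g ∈ Matrix.unitaryGroup (Fin N) ℂ) (hρ : Continuous ρ) (hN : 1 ≤ N)
    {z : G} (hz : z ∈ Subgroup.center G) {ω : ℂ} (hω : ρ z = ω • (1 : Matrix (Fin N) (Fin N) ℂ)) (hω1 : ‖ω‖ = 1) (hne : ω ≠ 1)
    {m n a b : ℕ} (hm : m + 1 = 2 ^ a) (hn : n + 1 = 2 ^ b) (hn1 : 1 ≤ n) {β : ℝ} (hβ0 : 0 < β) (hβ1 : β ≤ 1)
    (hβv : β * ∫ g, (max ((ρ g).trace.re) 0) ^ 2 ∂haarProbability G ≤ 4) :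
    ‖1 - ω‖ ^ 2 * ((∫ g, (max ((ρ g).trace.re) 0) ^ 2 ∂haarProbability G) / 768 * β) ^ ((2 * m + 2) * (2 * n + 2)) ≤
      8 * (N : ℝ) ^ ((2 * m + 2) * (2 * n + 2) + 2 * (2 * n + 2)) *
        (1 - twistedPartitionFunctionAniso ρ β (2 * n + 2) (2 * m + 2) z ⟨((0 : Fin 4), (3 : Fin 4)), by decide⟩ /
          twistedPartitionFunctionAniso ρ β (2 * n + 2) (2 * m + 2) 1 ⟨((0 : Fin 4), (3 : Fin 4)), by decide⟩) := by
  haveI : NeZero (2 * n + 2) := ⟨by omega⟩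
  haveI : NeZero (2 * m + 2) := ⟨by omega⟩
  set v : ℝ := ∫ g, (max ((ρ g).trace.re) 0) ^ 2 ∂haarProbability G with hv
  have hv0 : 0 < v := integral_pos_part_sq_trace_re_pos ρ hρ hN
  have hω0 : ω ≠ 0 := fun h => by simp [h] at hω1
  -- the finite-temperature side
  set Z : ℝ := ∫ U, FiniteTemperature.weight ρ β β U ∂(FiniteTemperature.haar 3 (2 * m + 2) (2 * n + 2) G) with hZ
  set R : ℝ := ∫ U, FiniteTemperature.stackTwistObs ρ β z⁻¹ (0 : Fin 3) 0 U * FiniteTemperature.weight ρ β β U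
    ∂(FiniteTemperature.haar 3 (2 * m + 2) (2 * n + 2) G) with hR
  have hZpos : 0 < Z := FiniteTemperature.partitionFunction_pos ρ hρ β β
  have ht : twistedPartitionFunctionAniso ρ β (2 * n + 2) (2 * m + 2) z ⟨((0 : Fin 4), (3 : Fin 4)), by decide⟩ /
      twistedPartitionFunctionAniso ρ β (2 * n + 2) (2 * m + 2) 1 ⟨((0 : Fin 4), (3 : Fin 4)), by decide⟩ = R / Z :=
    twistedPartitionFunctionAniso_03_div_eq ρ hρu β z
  -- Tomboulis–Yaffe for the inverse twist
  have hzi : z⁻¹ ∈ Subgroup.center G := inv_mem hz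
  have hωi : ρ z⁻¹ = ω⁻¹ • (1 : Matrix (Fin N) (Fin N) ℂ) := rep_inv_eq_inv_smul_one ρ hω hω0
  have hω1i : ‖ω⁻¹‖ = 1 := by rw [norm_inv, hω1, inv_one]
  have hTY := FiniteTemperature.normSq_plaquette_pow_le_one_sub_twist (d := 3) ρ hρu hρ β β (0 : Fin 3) hzi hωi hω1i hm hn hn1
    (0 : Fin 3 → ZMod (2 * n + 2))
  have hnorm : ‖1 - ω⁻¹‖ = ‖1 - ω‖ := by
    have h1 : (1 : ℂ) - ω⁻¹ = ω⁻¹ * (ω - 1) := by rw [mul_sub, inv_mul_cancel₀ hω0, mul_one]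
    rw [h1, norm_mul, norm_inv, hω1, inv_one, one_mul, norm_sub_rev]
  rw [hnorm] at hTY
  -- the temporal-plaquette floor
  have hb0 : b ≠ 0 := by
    rintro rfl
    simp at hn
    omega
  have h4 : 4 ∣ 2 * n + 2 := by
    have h2 : 2 ∣ n + 1 := by rw [hn]; exact dvd_pow_self 2 hb0
    obtain ⟨k, hk⟩ := h2
    exact ⟨k, by omega⟩
  have hβv2 : β ^ 2 * v ≤ 4 := by nlinarith [mul_nonneg hβ0.le hv0.le]
  have hPF := FiniteTemperature.expectation_elecPlaquette_ge_linear (d := 3) (L₀ := 2 * m + 2) (L := 2 * n + 2) ρ hρu hρ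
    (by norm_num) h4 hz hω hne hβ0 hβv2 β (0 : Fin 3) ((0 : ZMod (2 * m + 2)), (0 : Fin 3 → ZMod (2 * n + 2)))
  set Pc : ℂ := ∫ U, (ρ (FiniteTemperature.plaquette U ((0 : ZMod (2 * m + 2)), (0 : Fin 3 → ZMod (2 * n + 2))) none
      (some (0 : Fin 3)))).trace * (FiniteTemperature.weight ρ β β U : ℂ) ∂(FiniteTemperature.haar 3 (2 * m + 2) (2 * n + 2) G)
    with hPc
  set Pr : ℝ := ∫ U, (ρ (FiniteTemperature.plaquette U ((0 : ZMod (2 * m + 2)), (0 : Fin 3 → ZMod (2 * n + 2))) none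
      (some (0 : Fin 3)))).trace.re * FiniteTemperature.weight ρ β β U ∂(FiniteTemperature.haar 3 (2 * m + 2) (2 * n + 2) G)
    with hPr
  have hPre : Pr = Pc.re := by
    have hint : Integrable (fun U : FiniteTemperature.Config 3 (2 * m + 2) (2 * n + 2) G =>
        (ρ (FiniteTemperature.plaquette U ((0 : ZMod (2 * m + 2)), (0 : Fin 3 → ZMod (2 * n + 2))) none
          (some (0 : Fin 3)))).trace * (FiniteTemperature.weight ρ β β U : ℂ))
        (FiniteTemperature.haar 3 (2 * m + 2) (2 * n + 2) G) :=
      ((Continuous.matrix_trace (hρ.comp (FiniteTemperature.continuous_plaquette _ _ _))).mul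
        (Complex.continuous_ofReal.comp (FiniteTemperature.continuous_weight ρ hρ β β))).integrable_of_hasCompactSupport
        (HasCompactSupport.of_compactSpace _)
    have h := integral_re hint
    simp only [RCLike.re_to_complex] at h
    have hre : ∀ U : FiniteTemperature.Config 3 (2 * m + 2) (2 * n + 2) G,
        ((ρ (FiniteTemperature.plaquette U ((0 : ZMod (2 * m + 2)), (0 : Fin 3 → ZMod (2 * n + 2))) none
          (some (0 : Fin 3)))).trace * (FiniteTemperature.weight ρ β β U : ℂ)).re =
        (ρ (FiniteTemperature.plaquette U ((0 : ZMod (2 * m + 2)), (0 : Fin 3 → ZMod (2 * n + 2))) none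
          (some (0 : Fin 3)))).trace.re * FiniteTemperature.weight ρ β β U :=
      fun U => by rw [Complex.mul_re, Complex.ofReal_re, Complex.ofReal_im, mul_zero, sub_zero]
    simp_rw [hre] at h
    rw [hPr, hPc, h]
  have h768 : ((3 : ℕ) : ℝ) * (4 : ℝ) ^ (3 + 1) = 768 := by norm_num
  have hf : v / 768 * β ≤ ‖Pc‖ / Z := by
    have h1 : β * v / 768 ≤ Pr / Z := by
      have h := hPF
      rw [h768] at h
      exact h
    have h2 : Pr / Z ≤ ‖Pc‖ / Z := div_le_div_of_nonneg_right (by rw [hPre]; exact Complex.re_le_norm Pc) hZpos.le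
    have h3 : v / 768 * β = β * v / 768 := by ring
    rw [h3]
    exact h1.trans h2
  have hf0 : 0 ≤ v / 768 * β := by positivity
  rw [ht]
  calc ‖1 - ω‖ ^ 2 * (v / 768 * β) ^ ((2 * m + 2) * (2 * n + 2))
      ≤ ‖1 - ω‖ ^ 2 * (‖Pc‖ / Z) ^ ((2 * m + 2) * (2 * n + 2)) := by gcongr
    _ ≤ _ := hTY

/-- **CEILING** (Kotecký–Preiss).  Continuous `ρ` (`N ≥ 1`), central `z`, `0 < β` with `Nβ ≤ 1/(4·97²e²)`, every box `L_s³ × L_t`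
(`L_s, L_t ≥ 1`): `1 − Z(z;(0,3);L_s,L_t)/Z(1;(0,3);L_s,L_t) ≤ 12 L_s³ L_t (4·97²e·Nβ)^{L_sL_t}` (`1 − t ≤ |ln t|`).
[cite: ItoSeiler2008Further, §2 Thm 2.2 (1)] -/
theorem twistedPartitionFunctionAniso_03_ceiling (hρ : Continuous ρ) (hN : 1 ≤ N) {z : G} (hz : z ∈ Subgroup.center G)
    (Ls Lt : ℕ) [NeZero Ls] [NeZero Lt] {β : ℝ} (hβ0 : 0 < β) (hβK : (N : ℝ) * β ≤ 1 / (4 * ((97 : ℝ) ^ 2 * Real.exp 2))) :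
    1 - twistedPartitionFunctionAniso ρ β Ls Lt z ⟨((0 : Fin 4), (3 : Fin 4)), by decide⟩ /
        twistedPartitionFunctionAniso ρ β Ls Lt 1 ⟨((0 : Fin 4), (3 : Fin 4)), by decide⟩ ≤
      12 * ((Ls : ℝ) ^ 3 * Lt) * (4 * (97 : ℝ) ^ 2 * Real.exp 1 * ((N : ℝ) * β)) ^ (Ls * Lt) := by
  have hNr : (1 : ℝ) ≤ N := by exact_mod_cast hN
  have hZz := twistedPartitionFunctionAniso_pos ρ hρ β Ls Lt z ⟨((0 : Fin 4), (3 : Fin 4)), by decide⟩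
  have hZ1 := twistedPartitionFunctionAniso_pos ρ hρ β Ls Lt (1 : G) ⟨((0 : Fin 4), (3 : Fin 4)), by decide⟩
  have hNβ0 : 0 < (N : ℝ) * |β| := by rw [abs_of_pos hβ0]; positivity
  have hNβ : (N : ℝ) * |β| ≤ 1 / (4 * ((97 : ℝ) ^ 2 * Real.exp 2)) := by rw [abs_of_pos hβ0]; exact hβK
  have hKP := abs_log_twistedPartitionFunctionAniso_03_sub_le_pow (Ls := Ls) (Lt := Lt) ρ hρ hNβ0 hNβ hz
  rw [abs_of_pos hβ0] at hKP
  refine le_trans ?_ hKP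
  have ht'pos := div_pos hZz hZ1
  have hlog := Real.log_le_sub_one_of_pos ht'pos
  rw [Real.log_div hZz.ne' hZ1.ne'] at hlog
  have habs := neg_abs_le (Real.log (twistedPartitionFunctionAniso ρ β Ls Lt z ⟨((0 : Fin 4), (3 : Fin 4)), by decide⟩) -
    Real.log (twistedPartitionFunctionAniso ρ β Ls Lt 1 ⟨((0 : Fin 4), (3 : Fin 4)), by decide⟩))
  linarith

/-- **★★ One TIME doubling does not decrease the temporal-plane electric-flux ratio, at strong coupling, uniformly in `L_s`.**
Hypotheses as in `twistedPartitionFunctionAniso_03_ratio_le_spatial_double`; conclusion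
`Z(z;(0,3);L_s,L_t)/Z(1;(0,3);L_s,L_t) ≤ Z(z;(0,3);L_s,2L_t)/Z(1;(0,3);L_s,2L_t)` for `L_t = 2m+2`, `L_s = 2n+2`, `m + 1 = 2^a`,
`n + 1 = 2^b`, `n ≥ 1` (floor at `(L_s, L_t)` exponential in `L_sL_t`, ceiling at `(L_s, 2L_t)` exponential in `2L_sL_t`).
[cite: TomboulisYaffe1985, App. I and §2 eqs. (2.10)–(2.12)] [cite: ItoSeiler2008Further, §2 Thm 2.2 (1)] -/
theorem twistedPartitionFunctionAniso_03_ratio_le_time_double (hρu : ∀ g, ρ g ∈ Matrix.unitaryGroup (Fin N) ℂ)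
    (hρ : Continuous ρ) (hN : 1 ≤ N) {z : G} (hz : z ∈ Subgroup.center G) {ω : ℂ}
    (hω : ρ z = ω • (1 : Matrix (Fin N) (Fin N) ℂ)) (hω1 : ‖ω‖ = 1) (hne : ω ≠ 1) {m n a b : ℕ} (hm : m + 1 = 2 ^ a)
    (hn : n + 1 = 2 ^ b) (hn1 : 1 ≤ n) {β : ℝ} (hβ0 : 0 < β) (hβ1 : β ≤ 1)
    (hβv : β * ∫ g, (max ((ρ g).trace.re) 0) ^ 2 ∂haarProbability G ≤ 4)
    (hβK : (N : ℝ) * β ≤ 1 / (4 * ((97 : ℝ) ^ 2 * Real.exp 2)))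
    (hβδ : β ≤ (∫ g, (max ((ρ g).trace.re) 0) ^ 2 ∂haarProbability G) / 768 * ‖1 - ω‖ ^ 2 /
      (12288 * (4 * (97 : ℝ) ^ 2 * Real.exp 1) ^ 2 * (N : ℝ) ^ 4)) :
    twistedPartitionFunctionAniso ρ β (2 * n + 2) (2 * m + 2) z ⟨((0 : Fin 4), (3 : Fin 4)), by decide⟩ /
        twistedPartitionFunctionAniso ρ β (2 * n + 2) (2 * m + 2) 1 ⟨((0 : Fin 4), (3 : Fin 4)), by decide⟩ ≤
      twistedPartitionFunctionAniso ρ β (2 * n + 2) (2 * (2 * m + 2)) z ⟨((0 : Fin 4), (3 : Fin 4)), by decide⟩ /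
        twistedPartitionFunctionAniso ρ β (2 * n + 2) (2 * (2 * m + 2)) 1 ⟨((0 : Fin 4), (3 : Fin 4)), by decide⟩ := by
  haveI : NeZero (2 * n + 2) := ⟨by omega⟩
  haveI : NeZero (2 * (2 * m + 2)) := ⟨by omega⟩
  set v : ℝ := ∫ g, (max ((ρ g).trace.re) 0) ^ 2 ∂haarProbability G with hv
  have hv0 : 0 < v := integral_pos_part_sq_trace_re_pos ρ hρ hN
  have hNr : (1 : ℝ) ≤ N := by exact_mod_cast hN
  have hδ0 : 0 < ‖1 - ω‖ ^ 2 := by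
    have : ‖1 - ω‖ ≠ 0 := fun h => hne (by rw [norm_eq_zero, sub_eq_zero] at h; exact h.symm)
    positivity
  have hδ4 : ‖1 - ω‖ ^ 2 ≤ 4 := by
    have h2 : ‖1 - ω‖ ≤ 2 := by
      calc ‖1 - ω‖ ≤ ‖(1 : ℂ)‖ + ‖ω‖ := norm_sub_le _ _
        _ = 2 := by rw [norm_one, hω1]; norm_num
    nlinarith [norm_nonneg (1 - ω)]
  have hfloor := twistedPartitionFunctionAniso_03_floor ρ hρu hρ hN hz hω hω1 hne hm hn hn1 hβ0 hβ1 hβv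
  have hceil := twistedPartitionFunctionAniso_03_ceiling ρ hρ hN hz (2 * n + 2) (2 * (2 * m + 2)) hβ0 hβK
  have hC : (0 : ℝ) < 4 * (97 : ℝ) ^ 2 * Real.exp 1 := by positivity
  have harith := doubling_arith_time (N := (N : ℝ)) (C := 4 * (97 : ℝ) ^ 2 * Real.exp 1) (c := v / 768) (δ := ‖1 - ω‖ ^ 2) m n
    hNr hC (by positivity) hδ0 hδ4 hβ0 hβδ
  set t : ℝ := twistedPartitionFunctionAniso ρ β (2 * n + 2) (2 * m + 2) z ⟨((0 : Fin 4), (3 : Fin 4)), by decide⟩ /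
      twistedPartitionFunctionAniso ρ β (2 * n + 2) (2 * m + 2) 1 ⟨((0 : Fin 4), (3 : Fin 4)), by decide⟩ with ht
  set t' : ℝ := twistedPartitionFunctionAniso ρ β (2 * n + 2) (2 * (2 * m + 2)) z ⟨((0 : Fin 4), (3 : Fin 4)), by decide⟩ /
      twistedPartitionFunctionAniso ρ β (2 * n + 2) (2 * (2 * m + 2)) 1 ⟨((0 : Fin 4), (3 : Fin 4)), by decide⟩ with ht'
  have h8 : (0 : ℝ) < 8 * (N : ℝ) ^ ((2 * m + 2) * (2 * n + 2) + 2 * (2 * n + 2)) := by positivity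
  have key : (1 - t') * (8 * (N : ℝ) ^ ((2 * m + 2) * (2 * n + 2) + 2 * (2 * n + 2))) ≤
      (1 - t) * (8 * (N : ℝ) ^ ((2 * m + 2) * (2 * n + 2) + 2 * (2 * n + 2))) := by
    calc (1 - t') * (8 * (N : ℝ) ^ ((2 * m + 2) * (2 * n + 2) + 2 * (2 * n + 2)))
        ≤ 12 * ((((2 * n + 2 : ℕ) : ℝ)) ^ 3 * ((2 * (2 * m + 2) : ℕ) : ℝ)) *
            (4 * (97 : ℝ) ^ 2 * Real.exp 1 * ((N : ℝ) * β)) ^ ((2 * n + 2) * (2 * (2 * m + 2))) *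
            (8 * (N : ℝ) ^ ((2 * m + 2) * (2 * n + 2) + 2 * (2 * n + 2))) := by
          have := mul_le_mul_of_nonneg_right hceil h8.le
          exact_mod_cast this
      _ ≤ ‖1 - ω‖ ^ 2 * (v / 768 * β) ^ ((2 * m + 2) * (2 * n + 2)) := harith
      _ ≤ 8 * (N : ℝ) ^ ((2 * m + 2) * (2 * n + 2) + 2 * (2 * n + 2)) * (1 - t) := hfloor
      _ = (1 - t) * (8 * (N : ℝ) ^ ((2 * m + 2) * (2 * n + 2) + 2 * (2 * n + 2))) := mul_comm _ _
  have := le_of_mul_le_mul_right key h8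
  linarith

/-- **★★ The symmetric four-torus: one full doubling at strong coupling.**  Unitary continuous `ρ` (`N ≥ 1`), central `z` with `ρ(z) = ω·1`,
`|ω| = 1`, `ω ≠ 1`, `β` below the explicit threshold of `twistedPartitionFunctionAniso_03_ratio_le_spatial_double`; dyadic `L = 2n+2`,
`n + 1 = 2^b`, `n ≥ 1`: `Z_z(L)/Z_1(L) ≤ Z_z(2L)/Z_1(2L)` for 't Hooft's twisted partition function of the symmetric torus `(ℤ/L)⁴`, plane `(0,3)`
(`t_z(L, L) ≤ t_z(2L, L) ≤ t_z(2L, 2L)`). [cite: TomboulisYaffe1985, App. I and §2 eqs. (2.10)–(2.12)] [cite: tHooft1979Flux, §5] -/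
theorem twistedPartitionFunction_03_ratio_le_double (hρu : ∀ g, ρ g ∈ Matrix.unitaryGroup (Fin N) ℂ) (hρ : Continuous ρ) (hN : 1 ≤ N)
    {z : G} (hz : z ∈ Subgroup.center G) {ω : ℂ} (hω : ρ z = ω • (1 : Matrix (Fin N) (Fin N) ℂ)) (hω1 : ‖ω‖ = 1) (hne : ω ≠ 1)
    {n b : ℕ} (hn : n + 1 = 2 ^ b) (hn1 : 1 ≤ n) {β : ℝ} (hβ0 : 0 < β) (hβ1 : β ≤ 1)
    (hβv : β * ∫ g, (max ((ρ g).trace.re) 0) ^ 2 ∂haarProbability G ≤ 4)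
    (hβK : (N : ℝ) * β ≤ 1 / (4 * ((97 : ℝ) ^ 2 * Real.exp 2)))
    (hβδ : β ≤ (∫ g, (max ((ρ g).trace.re) 0) ^ 2 ∂haarProbability G) / 768 * ‖1 - ω‖ ^ 2 /
      (12288 * (4 * (97 : ℝ) ^ 2 * Real.exp 1) ^ 2 * (N : ℝ) ^ 4)) :
    twistedPartitionFunction ρ β (2 * n + 2) z (⟨((0 : Fin 4), (3 : Fin 4)), by decide⟩ : {p : Fin 4 × Fin 4 // p.1 < p.2}) /
        twistedPartitionFunction ρ β (2 * n + 2) 1 (⟨((0 : Fin 4), (3 : Fin 4)), by decide⟩ : {p : Fin 4 × Fin 4 // p.1 < p.2}) ≤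
      twistedPartitionFunction ρ β (2 * (2 * n + 2)) z (⟨((0 : Fin 4), (3 : Fin 4)), by decide⟩ : {p : Fin 4 × Fin 4 // p.1 < p.2}) /
        twistedPartitionFunction ρ β (2 * (2 * n + 2)) 1
          (⟨((0 : Fin 4), (3 : Fin 4)), by decide⟩ : {p : Fin 4 × Fin 4 // p.1 < p.2}) := by
  haveI : NeZero (2 * n + 2) := ⟨by omega⟩
  haveI : NeZero (2 * (2 * n + 2)) := ⟨by omega⟩
  -- spatial doubling at `(L, L)`, then time doubling at `(2L, L)`
  have h1 := twistedPartitionFunctionAniso_03_ratio_le_spatial_double ρ hρu hρ hN hz hω hω1 hne (m := n) (a := b) hn hn hn1 hβ0 hβ1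
    hβv hβK hβδ
  have hn' : (2 * n + 1) + 1 = 2 ^ (b + 1) := by rw [pow_succ]; omega
  have h2 := twistedPartitionFunctionAniso_03_ratio_le_time_double ρ hρu hρ hN hz hω hω1 hne (m := n) (a := b) hn hn' (by omega) hβ0
    hβ1 hβv hβK hβδ
  rw [show 2 * (2 * n + 1) + 2 = 2 * (2 * n + 2) by ring] at h2
  rw [← twistedPartitionFunctionAniso_self ρ (L := 2 * n + 2), ← twistedPartitionFunctionAniso_self ρ (L := 2 * n + 2),
    ← twistedPartitionFunctionAniso_self ρ (L := 2 * (2 * n + 2)), ← twistedPartitionFunctionAniso_self ρ (L := 2 * (2 * n + 2))]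
  exact h1.trans h2

omit [SecondCountableTopology G] in
/-- plumbing: transport along equal side lengths (the side enters `twistedPartitionFunction` through a `NeZero` instance). [folklore] -/
private theorem ratio_le_of_sides_eq {β : ℝ} {z : G} {L₁ L₂ L₁' L₂' : ℕ} [NeZero L₁] [NeZero L₂] [NeZero L₁'] [NeZero L₂']
    (h₁ : L₁ = L₁') (h₂ : L₂ = L₂')
    (h : twistedPartitionFunction ρ β L₁' z (⟨((0 : Fin 4), (3 : Fin 4)), by decide⟩ : {p : Fin 4 × Fin 4 // p.1 < p.2}) /
        twistedPartitionFunction ρ β L₁' 1 (⟨((0 : Fin 4), (3 : Fin 4)), by decide⟩ : {p : Fin 4 × Fin 4 // p.1 < p.2}) ≤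
      twistedPartitionFunction ρ β L₂' z (⟨((0 : Fin 4), (3 : Fin 4)), by decide⟩ : {p : Fin 4 × Fin 4 // p.1 < p.2}) /
        twistedPartitionFunction ρ β L₂' 1 (⟨((0 : Fin 4), (3 : Fin 4)), by decide⟩ : {p : Fin 4 × Fin 4 // p.1 < p.2})) :
    twistedPartitionFunction ρ β L₁ z (⟨((0 : Fin 4), (3 : Fin 4)), by decide⟩ : {p : Fin 4 × Fin 4 // p.1 < p.2}) /
        twistedPartitionFunction ρ β L₁ 1 (⟨((0 : Fin 4), (3 : Fin 4)), by decide⟩ : {p : Fin 4 × Fin 4 // p.1 < p.2}) ≤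
      twistedPartitionFunction ρ β L₂ z (⟨((0 : Fin 4), (3 : Fin 4)), by decide⟩ : {p : Fin 4 × Fin 4 // p.1 < p.2}) /
        twistedPartitionFunction ρ β L₂ 1 (⟨((0 : Fin 4), (3 : Fin 4)), by decide⟩ : {p : Fin 4 × Fin 4 // p.1 < p.2}) := by
  subst h₁ h₂
  exact h

/-- **★★★ 't Hooft's dyadic volume ratchet at strong coupling, temporal plane, scalar twist.**  For second-countable compact `G`, unitary
continuous `ρ : G →* M_N(ℂ)` (`N ≥ 1`) and central `z` with `ρ(z) = ω·1`, `|ω| = 1`, `ω ≠ 1`, there is an explicit `β₀ = β₀(ρ, ω) > 0`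
(`min (min 1 (4/v)) (min (1/(4·97²e²·N)) ((v/768)|1−ω|²/(12288 (4·97²e)² N⁴)))`, `v = ∫ ((Re tr ρ)₊)² dg`) such that for every
`0 < β ≤ β₀` and every `n ≥ 1` the single-plane vortex ratio of the symmetric four-torus does not decrease from side `2^{n+1}` to side
`2^{n+2}`:  `Z_z(2^{n+1})/Z_1(2^{n+1}) ≤ Z_z(2^{n+2})/Z_1(2^{n+2})` for the plane `q = (0,3)` (sides spelled `2^{n+1} − 2 + 2` as in the
summit's crux).  The strong-coupling model case of the volume ratchet: there `1 − t_z` is exponentially small in the area `L²` and consecutive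
dyadic tori differ by a factor `4` in area. [cite: TomboulisYaffe1985, App. I and §2 eqs. (2.10)–(2.12)] [cite: tHooft1979Flux, §5]
[cite: ItoSeiler2008Further, §2 Thm 2.2 (1)] -/
theorem exists_beta0_twistedPartitionFunction_03_dyadic_ratchet (hρu : ∀ g, ρ g ∈ Matrix.unitaryGroup (Fin N) ℂ) (hρ : Continuous ρ)
    (hN : 1 ≤ N) {z : G} (hz : z ∈ Subgroup.center G) {ω : ℂ} (hω : ρ z = ω • (1 : Matrix (Fin N) (Fin N) ℂ)) (hω1 : ‖ω‖ = 1)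
    (hne : ω ≠ 1) :
    ∃ β₀ : ℝ, 0 < β₀ ∧ ∀ β : ℝ, 0 < β → β ≤ β₀ → ∀ n : ℕ, 1 ≤ n →
      twistedPartitionFunction ρ β (2 ^ (n + 1) - 2 + 2) z (⟨((0 : Fin 4), (3 : Fin 4)), by decide⟩ : {p : Fin 4 × Fin 4 // p.1 < p.2}) /
          twistedPartitionFunction ρ β (2 ^ (n + 1) - 2 + 2) 1
            (⟨((0 : Fin 4), (3 : Fin 4)), by decide⟩ : {p : Fin 4 × Fin 4 // p.1 < p.2}) ≤
        twistedPartitionFunction ρ β (2 ^ (n + 2) - 2 + 2) z (⟨((0 : Fin 4), (3 : Fin 4)), by decide⟩ : {p : Fin 4 × Fin 4 // p.1 < p.2}) /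
          twistedPartitionFunction ρ β (2 ^ (n + 2) - 2 + 2) 1
            (⟨((0 : Fin 4), (3 : Fin 4)), by decide⟩ : {p : Fin 4 × Fin 4 // p.1 < p.2}) := by
  set v : ℝ := ∫ g, (max ((ρ g).trace.re) 0) ^ 2 ∂haarProbability G with hv
  have hv0 : 0 < v := integral_pos_part_sq_trace_re_pos ρ hρ hN
  have hNpos : (0 : ℝ) < N := by exact_mod_cast hN
  have hδ0 : 0 < ‖1 - ω‖ ^ 2 := by
    have : ‖1 - ω‖ ≠ 0 := fun h => hne (by rw [norm_eq_zero, sub_eq_zero] at h; exact h.symm)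
    positivity
  set K : ℝ := 4 * ((97 : ℝ) ^ 2 * Real.exp 2) with hK
  have hK0 : 0 < K := by positivity
  refine ⟨min (min 1 (4 / v)) (min (1 / (K * N)) (v / 768 * ‖1 - ω‖ ^ 2 / (12288 * (4 * (97 : ℝ) ^ 2 * Real.exp 1) ^ 2 * (N : ℝ) ^ 4))),
    by positivity, fun β hβ0 hβ n hn => ?_⟩
  have hβ1 : β ≤ 1 := hβ.trans ((min_le_left _ _).trans (min_le_left _ _))
  have hβv : β * v ≤ 4 := by
    have h : β ≤ 4 / v := hβ.trans ((min_le_left _ _).trans (min_le_right _ _))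
    exact (le_div_iff₀ hv0).1 h
  have hβK : (N : ℝ) * β ≤ 1 / K := by
    have h : β ≤ 1 / (K * N) := hβ.trans ((min_le_right _ _).trans (min_le_left _ _))
    rw [show 1 / (K * N) = 1 / K / (N : ℝ) by rw [div_div], le_div_iff₀ hNpos] at h
    linarith
  have hβδ : β ≤ v / 768 * ‖1 - ω‖ ^ 2 / (12288 * (4 * (97 : ℝ) ^ 2 * Real.exp 1) ^ 2 * (N : ℝ) ^ 4) :=
    hβ.trans ((min_le_right _ _).trans (min_le_right _ _))
  -- `2^{n+1} - 2 + 2 = 2k + 2`, `2^{n+2} - 2 + 2 = 2(2k+2)` with `k + 1 = 2^n`, `k ≥ 1`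
  have hn2 : 2 ^ 1 ≤ 2 ^ n := Nat.pow_le_pow_right (by norm_num) hn
  have hk : (2 ^ n - 1) + 1 = 2 ^ n := by omega
  have hk1 : 1 ≤ 2 ^ n - 1 := by simp at hn2; omega
  have e1 : 2 ^ (n + 1) - 2 + 2 = 2 * (2 ^ n - 1) + 2 := by rw [pow_succ]; omega
  have e2 : 2 ^ (n + 2) - 2 + 2 = 2 * (2 * (2 ^ n - 1) + 2) := by rw [pow_succ, pow_succ]; omega
  haveI : NeZero (2 * (2 ^ n - 1) + 2) := ⟨by omega⟩
  haveI : NeZero (2 * (2 * (2 ^ n - 1) + 2)) := ⟨by omega⟩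
  exact ratio_le_of_sides_eq ρ e1 e2 (twistedPartitionFunction_03_ratio_le_double ρ hρu hρ hN hz hω hω1 hne hk hk1 hβ0 hβ1 hβv hβK hβδ)

end Main

end Literature.MathematicalPhysics.QuantumFieldTheory
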